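import Summits.ResolutionOfSingularities.ResolutionOfSingularities.Theorems.EquisingularLiftEquisingularLiftSplit
import Summits.ResolutionOfSingularities.ResolutionOfSingularities.Theorems.EquisingularLiftEquisingularLiftReducedStalkOverIso
import Summits.ResolutionOfSingularities.ResolutionOfSingularities.Theorems.EquisingularLiftCampaignW45bEquisingularLiftNat
import HarnessLib

/-!
# [OURS · L1 W4.5(b) · EL♮] FIRST TOUCH: a non-regular point of the strict transform stays non-regular until a centre
# touches it — the necessity half `EquisingularLiftNat ⇒ ULT` (crux `EquisingularLiftNat` = stmt-ResolutionOfSingularities-20038)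

HONEST FRAMING. OURS (cell res-hironaka, crux chain w45b, slot W4.5(b)); NOT a statement of any manuscript; AI-written,
weaker than expert review. Helper `--supports stmt-ResolutionOfSingularities-20038 --as helper` (plan of record
L/w45b/CRUX-PLAN.md v3.0.1 §1.6 «ULT», L/w45b/EL-NATURAL/ULT-L0COMP-WORDS.md «Claim … EquisingularLiftNat p → ULT»).

THE ARGUMENT (first touch). In the E1-inductive closure of `(P, 𝟙, Y)` used by the item `EquisingularLiftNat`, fix a point
`x ∈ Y` at which the reduced closed subscheme `V(closure Y)` is NOT regular. A step `X'' = Bl_C X' → X'` whose centre misses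
the point `x'` over `x` is an isomorphism near `x'` (`IsBlowup.isIso_morphismRestrict`, GW I Prop. 13.91 (3)), the strict
transform `closure (τ⁻¹(Y' ∖ C))` agrees with `τ⁻¹(closure Y')` over the complement of the centre, so the point over `x`
survives and the stalk of the reduced strict transform there stays non-regular (`StrataSplit.stub_reducedStalkOverIso`).
Hence, if the last reduced strict transform is REGULAR (the item's conclusion), some step's centre contains the point over
`x`: the FIRST such step exhibits a stage `(X₀, σ₀, Y₀)` reached by steps all AVOIDING `x`, and a regular centre `C₀ ∋ x₀`,
`σ₀ x₀ = x`, over non-generic points of `Y`, with the E1 clause `C₀.support ∩ (σ₀ ≫ q)⁻¹{s₀} ⊆ Y₀` — the data ULT asks for.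

* `closure_preimage_diff_inter_compl_eq` — set bookkeeping: over the complement of the centre the strict transform is the
  preimage of `closure Y'`.
* `nonregular_point_persists` — ENGINE (one step).
* `exists_touching_centre_of_natChain` — the first-touch theorem for a general base `q : P → Spec O` (any local `O`), stated
  with the item's E1 step clause INLINE and the x-AVOIDING closure predicate INLINE (the item's clause plus the extra step
  hypothesis `x ∉ σ' '' C.support`, recorded LAST), so that it applies by `exact` to the typed `ULT` once filed.
* `exists_touching_centre_of_equisingularLiftNat` — instantiated at the item: `Theorems.EquisingularLiftNat p` ⇒ for the
  `O, π` it provides, every `φ, Y` and EVERY point `x ∈ Y` with non-regular `V(closure Y)`-stalk is touched as above.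
  (ULT(H, x) of the plan is the case `x` = generic point of a 1-dimensional component of the non-regular locus; the
  statement here needs no hypothesis on `x` beyond non-regularity.)

References: Görtz–Wedhorn I Prop. 13.91 (3) [GortzWedhorn2020]; Stacks 01J3 (reduced induced subscheme); tree:
`Split.existsUnique_preimage`, `Split.preimage_closure_inter_subset` (Theorems/EquisingularLiftEquisingularLiftSplit.lean),
`StrataSplit.stub_reducedStalkOverIso` (Theorems/EquisingularLiftEquisingularLiftReducedStalkOverIso.lean).
-/

set_option linter.dupNamespace false -- mandated namespace `Summit.<Summit>.<Problem>` of this single-conjunct summit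
set_option linter.overlappingInstances false -- item signatures carry `[IsDomain O] [IsDiscreteValuationRing O]`

open CategoryTheory AlgebraicGeometry TopologicalSpace Topology
open Literature.AlgebraicGeometry.Resolution
open AlgebraicGeometry.Scheme.IdealSheafData
open Summit.ResolutionOfSingularities.ResolutionOfSingularities.Theses.EquisingularLift.Split
open Summit.ResolutionOfSingularities.ResolutionOfSingularities.Cruxes.EquisingularLift.StrataSplit

namespace Summit.ResolutionOfSingularities.ResolutionOfSingularities.Cruxes.EquisingularLiftNat.Sections

/-! ## Set bookkeeping over the complement of the centre -/

/-- Over the complement of the centre of a blow-up `τ`, the strict transform `closure (τ⁻¹(Y' ∖ C))` (even closed once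
more, as the item's bookkeeping produces it) coincides with the preimage of `closure Y'`. [folklore] -/
theorem closure_preimage_diff_inter_compl_eq {X' X'' : Scheme.{0}} (τ : X'' ⟶ X') (C : X'.IdealSheafData)
    (hτ : IsBlowup τ C) (Y' : Set X') :
    closure (closure (τ ⁻¹' (Y' \ (C.support : Set X')))) ∩ τ ⁻¹' (C.support : Set X')ᶜ =
      τ ⁻¹' closure Y' ∩ τ ⁻¹' (C.support : Set X')ᶜ := by
  let Wc : X'.Opens := ⟨(C.support : Set X')ᶜ, C.support.isClosed.isOpen_compl⟩
  have hWc : IsIso (τ ∣_ Wc) := hτ.isIso_morphismRestrict disjoint_compl_left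
  rw [closure_closure]
  apply Set.Subset.antisymm
  · rintro y ⟨hy, hyC⟩
    refine ⟨?_, hyC⟩
    have h1 : closure (τ ⁻¹' (Y' \ (C.support : Set X'))) ⊆ τ ⁻¹' closure Y' :=
      (closure_mono (Set.preimage_mono fun _ h => h.1)).trans
        (τ.base.hom.continuous.closure_preimage_subset Y')
    exact h1 hy
  · rintro y ⟨hy, hyC⟩
    refine ⟨?_, hyC⟩
    -- `τ y ∈ closure Y' ∩ Wc ⊆ closure (Y' ∩ Wc) = closure (Y' \ C)`
    have h1 : τ y ∈ closure (Y' \ (C.support : Set X')) := by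
      have : τ y ∈ (Wc : Set X') ∩ closure Y' := ⟨hyC, hy⟩
      have h2 := Wc.isOpen.inter_closure this
      rw [Set.inter_comm] at h2
      exact h2
    exact preimage_closure_inter_subset τ hWc (Y' \ (C.support : Set X')) ⟨h1, hyC⟩

/-! ## ENGINE: one step whose centre misses the point -/

/-- **ENGINE (one step).** Let `τ : X'' → X'` be a blow-up along `C`, `Y' ⊆ X'`, and `x' ∈ Y'` a point OFF the centre at
which the reduced closed subscheme `V(closure Y')` is not regular (witnessed by the point `w` of `V(closure Y')` over `x'`).
Then there is a point `x''` of the strict transform `closure (τ⁻¹(Y' ∖ C))` over `x'` at which the reduced closed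
subscheme `V(closure (closure (τ⁻¹(Y' ∖ C))))` is not regular. [folklore; GW I Prop. 13.91 (3)] -/
theorem nonregular_point_persists {X' X'' : Scheme.{0}} (τ : X'' ⟶ X') (C : X'.IdealSheafData)
    (hτ : IsBlowup τ C) (Y' : Set X') {x' : X'} (hx'Y : x' ∈ Y') (hx'C : x' ∉ (C.support : Set X'))
    (w : ↥(vanishingIdeal (⟨closure Y', isClosed_closure⟩ : Closeds X')).subscheme)
    (hw : (vanishingIdeal (⟨closure Y', isClosed_closure⟩ : Closeds X')).subschemeι w = x')
    (hreg : ¬ IsRegularLocalRing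
      ((vanishingIdeal (⟨closure Y', isClosed_closure⟩ : Closeds X')).subscheme.presheaf.stalk w)) :
    ∃ x'' : X'', τ x'' = x' ∧ x'' ∈ closure (τ ⁻¹' (Y' \ (C.support : Set X'))) ∧
      ∃ z : ↥(vanishingIdeal (⟨closure (closure (τ ⁻¹' (Y' \ (C.support : Set X')))), isClosed_closure⟩ :
          Closeds X'')).subscheme,
        (vanishingIdeal (⟨closure (closure (τ ⁻¹' (Y' \ (C.support : Set X')))), isClosed_closure⟩ :
          Closeds X'')).subschemeι z = x'' ∧
        ¬ IsRegularLocalRing ((vanishingIdeal (⟨closure (closure (τ ⁻¹' (Y' \ (C.support : Set X')))),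
          isClosed_closure⟩ : Closeds X'')).subscheme.presheaf.stalk z) := by
  let Wc : X'.Opens := ⟨(C.support : Set X')ᶜ, C.support.isClosed.isOpen_compl⟩
  have hWc : IsIso (τ ∣_ Wc) := hτ.isIso_morphismRestrict disjoint_compl_left
  obtain ⟨x'', hx'', -⟩ := existsUnique_preimage τ hWc (y := x') hx'C
  have hmem : x'' ∈ closure (τ ⁻¹' (Y' \ (C.support : Set X'))) :=
    subset_closure (show τ x'' ∈ Y' \ (C.support : Set X') by rw [hx'']; exact ⟨hx'Y, hx'C⟩)
  refine ⟨x'', hx'', hmem, ?_⟩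
  set Z₂ : Closeds X'' := ⟨closure (closure (τ ⁻¹' (Y' \ (C.support : Set X')))), isClosed_closure⟩ with hZ₂
  have hx''Z₂ : x'' ∈ (Z₂ : Set X'') := by
    show x'' ∈ closure (closure (τ ⁻¹' (Y' \ (C.support : Set X'))))
    rw [closure_closure]; exact hmem
  obtain ⟨z, hz⟩ : x'' ∈ Set.range (vanishingIdeal Z₂).subschemeι := by
    rw [ComponentGluing.range_subschemeι_vanishingIdeal]; exact hx''Z₂
  refine ⟨z, hz, ?_⟩
  have hset : (Z₂ : Set X'') ∩ τ ⁻¹' (Wc : Set X') =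
      τ ⁻¹' ((⟨closure Y', isClosed_closure⟩ : Closeds X') : Set X') ∩ τ ⁻¹' (Wc : Set X') :=
    closure_preimage_diff_inter_compl_eq τ C hτ Y'
  have hzx : τ ((vanishingIdeal Z₂).subschemeι z) =
      (vanishingIdeal (⟨closure Y', isClosed_closure⟩ : Closeds X')).subschemeι w := by
    rw [hz, hw, hx'']
  have hxV : (vanishingIdeal (⟨closure Y', isClosed_closure⟩ : Closeds X')).subschemeι w ∈ Wc := by
    rw [hw]; exact hx'C
  rw [stub_reducedStalkOverIso X' X'' τ Wc hWc ⟨closure Y', isClosed_closure⟩ Z₂ hset z w hzx hxV]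
  exact hreg


/-! ## FIRST TOUCH along an E1-chain (general base) -/

/-- **FIRST TOUCH (general base).** Let `O` be a local ring, `q : P → Spec O`, `Y ⊆ P`, and `(P', σ, S')` in the
E1-inductive closure of `(P, 𝟙, Y)` (the item's clause, inlined) with `V(closure S')` REGULAR. Then every point `x ∈ Y`
at which `V(closure Y)` is not regular is TOUCHED: there are a stage `(X₀, σ₀, Y₀)` in the `x`-AVOIDING E1-inductive
closure (the item's step clause with the extra hypothesis `x ∉ σ' '' C.support`, recorded last) and an ideal sheaf `C₀`
on `X₀` with `V(C₀)` regular, a point `x₀ ∈ supp C₀` over `x`, `σ₀(supp C₀)` off the generic points of `Y`, and the E1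
clause `supp C₀ ∩ (σ₀ ≫ q)⁻¹{s₀} ⊆ Y₀`. Proof: run the closure on «touched ∨ (avoiding chain ∧ a non-regular point over
`x` survives)» with `nonregular_point_persists` as the engine; regularity at the end excludes the second alternative.
[folklore; GW I Prop. 13.91 (3)] -/
theorem exists_touching_centre_of_natChain {O : Type} [CommRing O] [IsLocalRing O] {P : AlgebraicGeometry.Scheme.{0}}
    (q : P ⟶ AlgebraicGeometry.Spec (.of O)) (Y : Set P) {P' : AlgebraicGeometry.Scheme.{0}} (σ : P' ⟶ P) (S' : Set P')
    (hch : (∀ Q : (∀ X' : AlgebraicGeometry.Scheme.{0}, (X' ⟶ P) → Set X' → Prop), Q P (CategoryTheory.CategoryStruct.id _) Y → (∀ (X' X'' : AlgebraicGeometry.Scheme.{0}) (σ' : X' ⟶ P) (Y' : Set X') (C : X'.IdealSheafData) (τ : X'' ⟶ X'), Q X' σ' Y' → Literature.AlgebraicGeometry.Resolution.IsBlowup τ C → Literature.AlgebraicGeometry.Resolution.Scheme.IsRegular C.subscheme → σ' '' (C.support : Set X') ⊆ {x | ¬ IsGenericPoint x Y} → (C.support : Set X') ∩ (CategoryTheory.CategoryStruct.comp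 σ' q) ⁻¹' {IsLocalRing.closedPoint O} ⊆ Y' → Q X'' (CategoryTheory.CategoryStruct.comp τ σ') (closure (τ ⁻¹' (Y' \ (C.support : Set X'))))) → Q P' σ S'))
    (hreg : Literature.AlgebraicGeometry.Resolution.Scheme.IsRegular (AlgebraicGeometry.Scheme.IdealSheafData.vanishingIdeal (⟨closure S', isClosed_closure⟩ : TopologicalSpace.Closeds P')).subscheme)
    {x : P} (hxY : x ∈ Y) (hx : (∃ w : ↥(AlgebraicGeometry.Scheme.IdealSheafData.vanishingIdeal (⟨closure Y, isClosed_closure⟩ : TopologicalSpace.Closeds P)).subscheme, (AlgebraicGeometry.Scheme.IdealSheafData.vanishingIdeal (⟨closure Y, isClosed_closure⟩ : TopologicalSpace.Closeds P)).subschemeι w = x ∧ ¬ IsRegularLocalRing ((AlgebraicGeometry.Scheme.IdealSheafData.vanishingIdeal (⟨closure Y, isClosed_closure⟩ : TopologicalSpace.Closeds P)).subscheme.presheaf.stalk w))) :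
    ∃ (X₀ : AlgebraicGeometry.Scheme.{0}) (σ₀ : X₀ ⟶ P) (Y₀ : Set X₀) (C₀ : X₀.IdealSheafData), (∀ Q : (∀ X' : AlgebraicGeometry.Scheme.{0}, (X' ⟶ P) → Set X' → Prop), Q P (CategoryTheory.CategoryStruct.id _) Y → (∀ (X' X'' : AlgebraicGeometry.Scheme.{0}) (σ' : X' ⟶ P) (Y' : Set X') (C : X'.IdealSheafData) (τ : X'' ⟶ X'), Q X' σ' Y' → Literature.AlgebraicGeometry.Resolution.IsBlowup τ C → Literature.AlgebraicGeometry.Resolution.Scheme.IsRegular C.subscheme → σ' '' (C.support : Set X') ⊆ {x | ¬ IsGenericPoint x Y} → (C.support : Set X') ∩ (CategoryTheory.CategoryStruct.comp σ' q) ⁻¹' {IsLocalRing.closedPoint O} ⊆ Y' → x ∉ σ' '' (C.support : Set X') → Q X'' (CategoryTheory.CategoryStruct.comp τ σ') (closure (τ ⁻¹' (Y' \ (C.support : Set X'))))) → Q X₀ σ₀ Y₀) ∧ Literature.AlgebraicGeometry.Resolution.Scheme.IsRegular C₀.subscheme ∧ (∃ x₀ : X₀, x₀ ∈ (C₀.support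 : Set X₀) ∧ σ₀ x₀ = x) ∧ σ₀ '' (C₀.support : Set X₀) ⊆ {x | ¬ IsGenericPoint x Y} ∧ (C₀.support : Set X₀) ∩ (CategoryTheory.CategoryStruct.comp σ₀ q) ⁻¹' {IsLocalRing.closedPoint O} ⊆ Y₀ := by
  -- the `x`-avoiding closure predicate and the surviving-point invariant, as local abbreviations
  let AV : ∀ X' : Scheme.{0}, (X' ⟶ P) → Set X' → Prop := fun X₀ σ₀ Y₀ =>
    (∀ Q : (∀ X' : AlgebraicGeometry.Scheme.{0}, (X' ⟶ P) → Set X' → Prop), Q P (CategoryTheory.CategoryStruct.id _) Y → (∀ (X' X'' : AlgebraicGeometry.Scheme.{0}) (σ' : X' ⟶ P) (Y' : Set X') (C : X'.IdealSheafData) (τ : X'' ⟶ X'), Q X' σ' Y' → Literature.AlgebraicGeometry.Resolution.IsBlowup τ C → Literature.AlgebraicGeometry.Resolution.Scheme.IsRegular C.subscheme → σ' '' (C.support : Set X') ⊆ {x | ¬ IsGenericPoint x Y} → (C.support : Set X') ∩ (CategoryTheory.CategoryStruct.comp σ' q) ⁻¹' {IsLocalRing.closedPoint O} ⊆ Y'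 → x ∉ σ' '' (C.support : Set X') → Q X'' (CategoryTheory.CategoryStruct.comp τ σ') (closure (τ ⁻¹' (Y' \ (C.support : Set X'))))) → Q X₀ σ₀ Y₀)
  let NR : ∀ X' : Scheme.{0}, (X' ⟶ P) → Set X' → Prop := fun X' σ' Y' =>
    ∃ x' : X', x' ∈ Y' ∧ σ' x' = x ∧ (∃ w : ↥(AlgebraicGeometry.Scheme.IdealSheafData.vanishingIdeal (⟨closure Y', isClosed_closure⟩ : TopologicalSpace.Closeds X')).subscheme, (AlgebraicGeometry.Scheme.IdealSheafData.vanishingIdeal (⟨closure Y', isClosed_closure⟩ : TopologicalSpace.Closeds X')).subschemeι w = x' ∧ ¬ IsRegularLocalRing ((AlgebraicGeometry.Scheme.IdealSheafData.vanishingIdeal (⟨closure Y', isClosed_closure⟩ : TopologicalSpace.Closeds X')).subscheme.presheaf.stalk w))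
  -- run the E1-closure on «GOAL ∨ (AV ∧ NR)»
  have key := hch (fun X' σ' Y' => (∃ (X₀ : AlgebraicGeometry.Scheme.{0}) (σ₀ : X₀ ⟶ P) (Y₀ : Set X₀) (C₀ : X₀.IdealSheafData), (∀ Q : (∀ X' : AlgebraicGeometry.Scheme.{0}, (X' ⟶ P) → Set X' → Prop), Q P (CategoryTheory.CategoryStruct.id _) Y → (∀ (X' X'' : AlgebraicGeometry.Scheme.{0}) (σ' : X' ⟶ P) (Y' : Set X') (C : X'.IdealSheafData) (τ : X'' ⟶ X'), Q X' σ' Y' → Literature.AlgebraicGeometry.Resolution.IsBlowup τ C → Literature.AlgebraicGeometry.Resolution.Scheme.IsRegular C.subscheme → σ' '' (C.support : Set X') ⊆ {x | ¬ IsGenericPoint x Y} → (C.support : Set X') ∩ (CategoryTheory.CategoryStruct.comp σ' q) ⁻¹' {IsLocalRing.closedPoint O} ⊆ Y' → x ∉ σ' '' (C.support : Set X') → Q X'' (CategoryTheory.CategoryStruct.comp τ σ') (closure (τ ⁻¹' (Y' \ (C.support : Set X'))))) → Q X₀ σ₀ Y₀) ∧ Literature.AlgebraicGeometry.Resolution.Scheme.IsRegular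 C₀.subscheme ∧ (∃ x₀ : X₀, x₀ ∈ (C₀.support : Set X₀) ∧ σ₀ x₀ = x) ∧ σ₀ '' (C₀.support : Set X₀) ⊆ {x | ¬ IsGenericPoint x Y} ∧ (C₀.support : Set X₀) ∩ (CategoryTheory.CategoryStruct.comp σ₀ q) ⁻¹' {IsLocalRing.closedPoint O} ⊆ Y₀) ∨ (AV X' σ' Y' ∧ NR X' σ' Y')) ?_ ?_
  · rcases key with hG | ⟨-, x', -, -, w, -, hw⟩
    · exact hG
    · exact absurd (hreg w) hw
  · -- base: nothing touched yet; `x` itself survives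
    refine Or.inr ⟨fun Q h0 _ => h0, x, hxY, by simp, hx⟩
  · intro X' X'' σ' Y' C τ hQ hbl hC hgen hE1
    rcases hQ with hG | ⟨hav, x', hx'Y, hx'x, w, hw, hwreg⟩
    · exact Or.inl hG
    · by_cases hxc : x ∈ σ' '' (C.support : Set X')
      · -- FIRST TOUCH: this step's centre contains a point over `x`
        obtain ⟨x₀, hx₀, hx₀x⟩ := hxc
        exact Or.inl ⟨X', σ', Y', C, hav, hC, ⟨x₀, hx₀, hx₀x⟩, hgen, hE1⟩
      · -- the centre misses `x`: the avoiding chain extends and the non-regular point survives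
        refine Or.inr ⟨fun Q h0 hs => hs X' X'' σ' Y' C τ (hav Q h0 hs) hbl hC hgen hE1 hxc, ?_⟩
        have hx'C : x' ∉ (C.support : Set X') := fun h => hxc ⟨x', h, hx'x⟩
        obtain ⟨x'', hx'', hmem, z, hz, hzreg⟩ := nonregular_point_persists τ C hbl Y' hx'Y hx'C w hw hwreg
        refine ⟨x'', hmem, ?_, z, hz, hzreg⟩
        rw [Scheme.Hom.comp_apply, hx'', hx'x]

/-! ## FIRST TOUCH for the item `EquisingularLiftNat` -/

/-- **FIRST TOUCH for EL♮** (`Theorems.EquisingularLiftNat p` ⇒ the necessary condition ULT at EVERY non-regular point).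
If `EquisingularLiftNat p` holds then, for the `O, π` it provides and every `φ, Y` as in the item, every point `x ∈ Y`
at which the reduced closed subscheme `V(closure Y)` (`≅ H`) is not regular is touched by a regular centre after an
`x`-avoiding E1-chain: `∃ (X₀, σ₀, Y₀)` in the `x`-avoiding E1-inductive closure of `(ℙⁿ_O, 𝟙, Y)` and `C₀` with `V(C₀)`
regular, `∃ x₀ ∈ supp C₀` over `x`, `σ₀(supp C₀)` off the generic points of `Y`, and E1 `supp C₀ ∩ (σ₀ ≫ q)⁻¹{s₀} ⊆ Y₀`.
The plan's ULT(H, x) (CRUX-PLAN v3 §1.6; ULT-L0COMP-WORDS) is the case «`x` = generic point of a 1-dimensional component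
of the non-regular locus»; a single `(H, x)` violating the conclusion refutes `EquisingularLiftNat p` (K-LSE-0 (iii)).
[OURS · L1 W4.5b] [folklore] -/
theorem exists_touching_centre_of_equisingularLiftNat {p : ℕ}
    (h : Summit.ResolutionOfSingularities.ResolutionOfSingularities.Theorems.EquisingularLiftNat p) :
    p.Prime → ∀ (k : Type) [Field k] [CharP k p] [IsAlgClosed k] (n : ℕ) (H : AlgebraicGeometry.Scheme.{0}) (ι : H ⟶ (Literature.AlgebraicGeometry.Motives.projectiveSpace n k).left), AlgebraicGeometry.IsClosedImmersion ι → AlgebraicGeometry.IsIntegral H → (∀ y : (Literature.AlgebraicGeometry.Motives.projectiveSpace n k).left, ∃ U : (Literature.AlgebraicGeometry.Motives.projectiveSpace n k).left.affineOpens, y ∈ (U : (Literature.AlgebraicGeometry.Motives.projectiveSpace n k).left.Opens) ∧ (ι.ker.ideal U).IsPrincipal) → ∃ (O : Type) (_ : CommRing O) (_ : IsDomain O) (_ : IsDiscreteValuationRing O) (_ : CharZero O) (π : O →+* k), Function.Surjective π ∧ (letI := MvPolynomial.gradedAlgebra (σ := Fin (n + 1)) (R := O); letI := MvPolynomial.gradedAlgebra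 (σ := Fin (n + 1)) (R := k); ∀ (φ : MvPolynomial.homogeneousSubmodule (Fin (n + 1)) O →+*ᵍ MvPolynomial.homogeneousSubmodule (Fin (n + 1)) k) (hφ' : HomogeneousIdeal.irrelevant (MvPolynomial.homogeneousSubmodule (Fin (n + 1)) k) ≤ (HomogeneousIdeal.irrelevant (MvPolynomial.homogeneousSubmodule (Fin (n + 1)) O)).map φ), (∀ s, φ s = MvPolynomial.map π s) → ∀ Y : Set (AlgebraicGeometry.Proj (MvPolynomial.homogeneousSubmodule (Fin (n + 1)) O)), Y = Set.range (CategoryTheory.CategoryStruct.comp ι (AlgebraicGeometry.Proj.map φ hφ') : H ⟶ (AlgebraicGeometry.Proj (MvPolynomial.homogeneousSubmodule (Fin (n + 1)) O))) → ∀ x : (AlgebraicGeometry.Proj (MvPolynomial.homogeneousSubmodule (Fin (n + 1)) O)), x ∈ Y → (∃ w : ↥(AlgebraicGeometry.Scheme.IdealSheafData.vanishingIdeal (⟨closure Y, isClosed_closure⟩ : TopologicalSpace.Closeds (AlgebraicGeometry.Proj (MvPolynomial.homogeneousSubmodule (Fin (n + 1)) O)))).subscheme, (AlgebraicGeometry.Scheme.IdealSheafData.vanishingIdeal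 (⟨closure Y, isClosed_closure⟩ : TopologicalSpace.Closeds (AlgebraicGeometry.Proj (MvPolynomial.homogeneousSubmodule (Fin (n + 1)) O)))).subschemeι w = x ∧ ¬ IsRegularLocalRing ((AlgebraicGeometry.Scheme.IdealSheafData.vanishingIdeal (⟨closure Y, isClosed_closure⟩ : TopologicalSpace.Closeds (AlgebraicGeometry.Proj (MvPolynomial.homogeneousSubmodule (Fin (n + 1)) O)))).subscheme.presheaf.stalk w)) → ∃ (X₀ : AlgebraicGeometry.Scheme.{0}) (σ₀ : X₀ ⟶ (AlgebraicGeometry.Proj (MvPolynomial.homogeneousSubmodule (Fin (n + 1)) O))) (Y₀ : Set X₀) (C₀ : X₀.IdealSheafData), (∀ Q : (∀ X' : AlgebraicGeometry.Scheme.{0}, (X' ⟶ (AlgebraicGeometry.Proj (MvPolynomial.homogeneousSubmodule (Fin (n + 1)) O))) → Set X' → Prop), Q (AlgebraicGeometry.Proj (MvPolynomial.homogeneousSubmodule (Fin (n + 1)) O)) (CategoryTheory.CategoryStruct.id _) Y → (∀ (X' X'' : AlgebraicGeometry.Scheme.{0}) (σ' : X' ⟶ (AlgebraicGeometry.Proj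 (MvPolynomial.homogeneousSubmodule (Fin (n + 1)) O))) (Y' : Set X') (C : X'.IdealSheafData) (τ : X'' ⟶ X'), Q X' σ' Y' → Literature.AlgebraicGeometry.Resolution.IsBlowup τ C → Literature.AlgebraicGeometry.Resolution.Scheme.IsRegular C.subscheme → σ' '' (C.support : Set X') ⊆ {x | ¬ IsGenericPoint x Y} → (C.support : Set X') ∩ (CategoryTheory.CategoryStruct.comp σ' (CategoryTheory.CategoryStruct.comp (AlgebraicGeometry.Proj.toSpecZero (MvPolynomial.homogeneousSubmodule (Fin (n + 1)) O)) (AlgebraicGeometry.Spec.map (CommRingCat.ofHom (algebraMap O (MvPolynomial.homogeneousSubmodule (Fin (n + 1)) O 0)))))) ⁻¹' {IsLocalRing.closedPoint O} ⊆ Y' → x ∉ σ' '' (C.support : Set X') → Q X'' (CategoryTheory.CategoryStruct.comp τ σ') (closure (τ ⁻¹' (Y' \ (C.support : Set X'))))) → Q X₀ σ₀ Y₀) ∧ Literature.AlgebraicGeometry.Resolution.Scheme.IsRegular C₀.subscheme ∧ (∃ x₀ : X₀, x₀ ∈ (C₀.support : Set X₀) ∧ σ₀ x₀ = x) ∧ σ₀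 '' (C₀.support : Set X₀) ⊆ {x | ¬ IsGenericPoint x Y} ∧ (C₀.support : Set X₀) ∩ (CategoryTheory.CategoryStruct.comp σ₀ (CategoryTheory.CategoryStruct.comp (AlgebraicGeometry.Proj.toSpecZero (MvPolynomial.homogeneousSubmodule (Fin (n + 1)) O)) (AlgebraicGeometry.Spec.map (CommRingCat.ofHom (algebraMap O (MvPolynomial.homogeneousSubmodule (Fin (n + 1)) O 0)))))) ⁻¹' {IsLocalRing.closedPoint O} ⊆ Y₀) := by
  intro hp k _ _ _ n H ι hι hH hloc
  obtain ⟨O, i1, i2, i3, i4, π, hπ, h'⟩ := h hp k n H ι hι hH hloc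
  refine ⟨O, i1, i2, i3, i4, π, hπ, ?_⟩
  intro φ hφ' hφ Y hY x hxY hx
  obtain ⟨P', σ, S', hchain, -, hreg⟩ := h' φ hφ' hφ Y hY
  exact exists_touching_centre_of_natChain _ Y σ S' hchain hreg hxY hx

end Summit.ResolutionOfSingularities.ResolutionOfSingularities.Cruxes.EquisingularLiftNat.Sections
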